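import Summits.NavierStokesRegularity.NavierStokesRegularity.Theorems.CoriolisHeadTypeIRateGradientTransport
import Summits.NavierStokesRegularity.NavierStokesRegularity.Theorems.CoriolisHeadTypeIRateOfGradientDecay
import HarnessLib

/-!
# CoriolisHeadTypeIRateOfLaplacianGradientDecay — crux `NoCoRotatingCore` (stmt-NavierStokesRegularity-22676),
# line `far_field_constancy` v2 (skeleton 15c9a82ad206abb9), stub K1c `stub_typeIRate`:
# **K1c from `O(r⁻²)` decay of `∇ΔU` and of the pressure Hessian**

`TypeIRate.typeIRate_of_laplacian_gradient_and_hessian_decay`: let `(U, P)` be a bounded smooth rotated Leray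
profile (`ν, a > 0`, `B` skew) with the line's K1a (scale-natural derivative decay) and K1b's conclusion `U → b`.
IF beyond some radius `‖D(ΔU)(y)‖ ≤ C₃/‖y‖²` (implied by scale-natural decay of the THIRD derivative,
`r³‖D³U‖ → 0` — «K1a₃») and `‖D(∇P)(y)‖ ≤ C_H/‖y‖²` (the PRESSURE-HESSIAN bound), THEN `‖U(y) − b‖ ≤ K/(1 + ‖y‖)`.
Chain (all landed): the gradient `DU` solves the matrix transport system with damping `2a`
(`fderiv_transport_form_of_rotated`) with forcing `νD(ΔU) − DU∘DU − D(DU)(U) − D(∇P) = O(r⁻²)` (K1a(1) gives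
`‖DU‖ ≤ 1/r`, `‖D²U‖ ≤ 1/r²`); the matrix transport lemma `sq_mul_norm_le_of_transport_two` gives
`r²‖DU(y)‖ ≤ R² + (D/a) log(r/R)`, hence the POWER GAIN `‖DU(y)‖ ≤ C₁/r^{3/2}` (`log x ≤ 2√x`); and
`typeIRate_of_fderiv_power_decay` (`CoriolisHeadTypeIRateOfGradientDecay`: pressure rate by dyadic telescoping +
transport half) concludes.

HONEST FRAMING / WHAT REMAINS.  K1c as registered (K1a only) stays OPEN.  After this file the line's analytic
content beyond the printed residual is: K1a₃ (scale-natural decay to third order — same nature as K1a) and the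
pressure-Hessian bound `‖D²P‖ = O(r⁻²)`, which is expected from K1a by the centred dyadic telescoping of
`CoriolisHeadTypeIRatePressureKernel/Rate` with ONE MORE integration by parts (`|D²K_c| ≲ c⁻³`, tree
`fderiv2_newtonFar_scale`) and the mean-zero trick on small scales (`∫ D²K_c = 0`, `‖∇ΔP‖ ≤ 6‖DU‖‖D²U‖`); that file
is not written here.  Nothing here proves `NoCoRotatingCore`, Pineau–Vicol's Conjecture 1.1 or NS regularity.

References: line card `Cruxes/NoCoRotatingCore/Lines/far_field_constancy.md`; B. Pineau, V. Vicol,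
arXiv:2607.09619 (2026), Prop. 3.1 [PineauVicol2026]; H. Jia, V. Šverák, Invent. Math. 196 (2014) §4 [JiaSverak2014].
-/

noncomputable section

open Set Function Filter Topology Metric InnerProductSpace Real

-- the summit and its single sub-problem share the name (CONVENTIONS §1), as in every Theorems file
set_option linter.dupNamespace false
-- nested operator types `ℝ³ →L[ℝ] ℝ³ →L[ℝ] ℝ³` inside the Banach algebra `ℝ³ →L[ℝ] ℝ³`
set_option maxSynthPendingDepth 3

namespace Summit.NavierStokesRegularity.NavierStokesRegularity.Theorems.CoriolisHead

namespace TypeIRate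

open Literature.Analysis.FluidPDE
open scoped RealInnerProductSpace Laplacian ContDiff

/-! ## §3 K1c from third-order scale-natural decay and a pressure-Hessian bound -/

section Profile2

variable {ν a : ℝ} {B : EuclideanSpace ℝ (Fin 3) →L[ℝ] EuclideanSpace ℝ (Fin 3)}
  {U : EuclideanSpace ℝ (Fin 3) → EuclideanSpace ℝ (Fin 3)} {P : EuclideanSpace ℝ (Fin 3) → ℝ}

/-- **K1c from `O(r⁻²)` decay of `∇ΔU` and of the pressure Hessian.**  For a bounded smooth rotated Leray
profile with K1a, `U → b`, and beyond some radius `‖D(ΔU)(y)‖ ≤ C₃/‖y‖²` (implied by scale-natural decay of the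
THIRD derivative, `r³‖D³U‖ → 0`) and `‖D(∇P)(y)‖ ≤ C_H/‖y‖²` (the pressure-Hessian bound — the one remaining
ELLIPTIC input, expected from K1a by the centred dyadic telescoping with two integrations by parts), the Type-I rate
`‖U(y) − b‖ ≤ K/(1 + ‖y‖)` holds.  Proof: the gradient `DU` solves the matrix transport system with damping `2a`
(`fderiv_transport_form_of_rotated`) whose forcing is `O(r⁻²)`; `sq_mul_norm_le_of_transport_two` gives
`r²‖DU‖ ≤ R² + (D/a) log(r/R)`, hence `‖DU‖ ≤ C₁/r^{3/2}` — a power gain — and `typeIRate_of_fderiv_power_decay`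
concludes.  HONEST FRAMING: K1c as registered, K1a, `NoCoRotatingCore`, Pineau–Vicol's conjecture and NS regularity
stay OPEN. [cite: PineauVicol2026, Prop. 3.1] -/
theorem typeIRate_of_laplacian_gradient_and_hessian_decay (hν : 0 < ν) (ha : 0 < a)
    (hB : ∀ x, inner ℝ (B x) x = 0) (hU : ContDiff ℝ (⊤ : ℕ∞) U) (hP : ContDiff ℝ 2 P)
    (hdiv : VectorCalculus.IsDivFree U)
    (heq : ∀ y, -(ν • (Δ U) y) + a • U y + a • fderiv ℝ U y y + (B (U y) - fderiv ℝ U y (B y)) +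
      convect U U y + gradient P y = 0)
    (hbdd : ∃ M : ℝ, ∀ y, ‖U y‖ ≤ M)
    (hdecay : ∀ ε : ℝ, 0 < ε → ∃ R : ℝ, ∀ y : EuclideanSpace ℝ (Fin 3), R ≤ ‖y‖ →
      ‖y‖ * ‖fderiv ℝ U y‖ + ‖y‖ ^ 2 * ‖iteratedFDeriv ℝ 2 U y‖ ≤ ε)
    (b : EuclideanSpace ℝ (Fin 3))
    (hlim : ∀ ε : ℝ, 0 < ε → ∃ R : ℝ, ∀ y : EuclideanSpace ℝ (Fin 3), R ≤ ‖y‖ → ‖U y - b‖ ≤ ε)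
    (hΔ3 : ∃ C₃ R₃ : ℝ, ∀ y : EuclideanSpace ℝ (Fin 3), R₃ ≤ ‖y‖ → ‖fderiv ℝ (Δ U) y‖ ≤ C₃ / ‖y‖ ^ 2)
    (hHess : ∃ CH RH : ℝ, ∀ y : EuclideanSpace ℝ (Fin 3), RH ≤ ‖y‖ →
      ‖fderiv ℝ (gradient P) y‖ ≤ CH / ‖y‖ ^ 2) :
    ∃ K : ℝ, ∀ y : EuclideanSpace ℝ (Fin 3), ‖U y - b‖ ≤ K / (1 + ‖y‖) := by
  obtain ⟨M, hM⟩ := hbdd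
  have hM0 : 0 ≤ M := (norm_nonneg _).trans (hM 0)
  obtain ⟨C₃, R₃, hC₃⟩ := hΔ3
  obtain ⟨CH, RH, hCH⟩ := hHess
  have hU2 : ContDiff ℝ 2 U := hU.of_le (by norm_cast)
  have hDUd : Differentiable ℝ (fderiv ℝ U) :=
    (hU2.fderiv_right (m := 1) (by norm_cast)).differentiable one_ne_zero
  -- nonnegative versions of the constants
  have hC₃' : ∀ y : EuclideanSpace ℝ (Fin 3), R₃ ≤ ‖y‖ → ‖fderiv ℝ (Δ U) y‖ ≤ max C₃ 0 / ‖y‖ ^ 2 :=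
    fun y hy => (hC₃ y hy).trans (div_le_div_of_nonneg_right (le_max_left _ _) (sq_nonneg _))
  have hCH' : ∀ y : EuclideanSpace ℝ (Fin 3), RH ≤ ‖y‖ → ‖fderiv ℝ (gradient P) y‖ ≤ max CH 0 / ‖y‖ ^ 2 :=
    fun y hy => (hCH y hy).trans (div_le_div_of_nonneg_right (le_max_left _ _) (sq_nonneg _))
  -- K1a at level `1`
  obtain ⟨R₁, hR₁1, hR₁⟩ := FarFieldLimit.exists_radius_decay hdecay one_pos
  set R : ℝ := max R₁ (max R₃ RH) with hRdef
  have hR1 : 1 ≤ R := hR₁1.trans (le_max_left _ _)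
  have hRpos : 0 < R := one_pos.trans_le hR1
  have hRR₁ : R₁ ≤ R := le_max_left _ _
  have hRR₃ : R₃ ≤ R := (le_max_left _ _).trans (le_max_right _ _)
  have hRRH : RH ≤ R := (le_max_right _ _).trans (le_max_right _ _)
  -- the norm of `fderiv (fderiv U)` is the norm of `iteratedFDeriv 2 U`
  have hnorm2 : ∀ x, ‖fderiv ℝ (fderiv ℝ U) x‖ = ‖iteratedFDeriv ℝ 2 U x‖ := fun x => by
    rw [← norm_iteratedFDeriv_zero (𝕜 := ℝ) (f := fderiv ℝ (fderiv ℝ U)), norm_iteratedFDeriv_fderiv,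
      norm_iteratedFDeriv_fderiv]
  -- the forcing bound `‖G(y)‖ ≤ D/‖y‖²`
  set D : ℝ := ν * max C₃ 0 + 1 + M + max CH 0 with hDdef
  have hD0 : 0 ≤ D := by positivity
  have hG : ∀ y : EuclideanSpace ℝ (Fin 3), R ≤ ‖y‖ →
      ‖fderiv ℝ (fderiv ℝ U) y (a • y - B y) + (2 * a) • fderiv ℝ U y +
        ((B.comp (fderiv ℝ U y)) - (fderiv ℝ U y).comp B)‖ ≤ D / ‖y‖ ^ 2 := by
    intro y hy
    have hypos : 0 < ‖y‖ := hRpos.trans_le hy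
    have hy1 : 1 ≤ ‖y‖ := hR1.trans hy
    obtain ⟨hD1, hD2⟩ := hR₁ y (hRR₁.trans hy)
    -- rewrite the transport expression through the differentiated system
    have hident : fderiv ℝ (fderiv ℝ U) y (a • y - B y) + (2 * a) • fderiv ℝ U y +
        ((B.comp (fderiv ℝ U y)) - (fderiv ℝ U y).comp B) =
        ν • fderiv ℝ (Δ U) y - (fderiv ℝ U y).comp (fderiv ℝ U y) - fderiv ℝ (fderiv ℝ U) y (U y)
          - fderiv ℝ (gradient P) y := by
      refine ContinuousLinearMap.ext fun e => ?_
      have h := fderiv_transport_form_of_rotated hU hP heq y e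
      simp only [_root_.add_apply, _root_.sub_apply, _root_.smul_apply, ContinuousLinearMap.comp_apply]
      rw [← add_sub_assoc]
      exact h
    rw [hident]
    -- the four terms
    have t1 : ‖ν • fderiv ℝ (Δ U) y‖ ≤ ν * max C₃ 0 / ‖y‖ ^ 2 := by
      rw [norm_smul, Real.norm_of_nonneg hν.le, mul_div_assoc]
      exact mul_le_mul_of_nonneg_left (hC₃' y (hRR₃.trans hy)) hν.le
    have t2 : ‖(fderiv ℝ U y).comp (fderiv ℝ U y)‖ ≤ 1 / ‖y‖ ^ 2 := by
      refine (ContinuousLinearMap.opNorm_comp_le _ _).trans ?_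
      calc ‖fderiv ℝ U y‖ * ‖fderiv ℝ U y‖ ≤ (1 / ‖y‖) * (1 / ‖y‖) :=
            mul_le_mul hD1 hD1 (norm_nonneg _) (by positivity)
        _ = 1 / ‖y‖ ^ 2 := by rw [div_mul_div_comm, one_mul, pow_two]
    have t3 : ‖fderiv ℝ (fderiv ℝ U) y (U y)‖ ≤ M / ‖y‖ ^ 2 := by
      calc ‖fderiv ℝ (fderiv ℝ U) y (U y)‖ ≤ ‖fderiv ℝ (fderiv ℝ U) y‖ * ‖U y‖ :=
            ContinuousLinearMap.le_opNorm _ _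
        _ ≤ (1 / ‖y‖ ^ 2) * M := by
            rw [hnorm2]
            exact mul_le_mul hD2 (hM y) (norm_nonneg _) (by positivity)
        _ = M / ‖y‖ ^ 2 := by ring
    have t4 : ‖fderiv ℝ (gradient P) y‖ ≤ max CH 0 / ‖y‖ ^ 2 := hCH' y (hRRH.trans hy)
    have s1 := norm_sub_le (ν • fderiv ℝ (Δ U) y - (fderiv ℝ U y).comp (fderiv ℝ U y) -
      fderiv ℝ (fderiv ℝ U) y (U y)) (fderiv ℝ (gradient P) y)
    have s2 := norm_sub_le (ν • fderiv ℝ (Δ U) y - (fderiv ℝ U y).comp (fderiv ℝ U y))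
      (fderiv ℝ (fderiv ℝ U) y (U y))
    have s3 := norm_sub_le (ν • fderiv ℝ (Δ U) y) ((fderiv ℝ U y).comp (fderiv ℝ U y))
    have e : D / ‖y‖ ^ 2 = ν * max C₃ 0 / ‖y‖ ^ 2 + 1 / ‖y‖ ^ 2 + M / ‖y‖ ^ 2 + max CH 0 / ‖y‖ ^ 2 := by
      rw [hDdef]; field_simp
    rw [e]
    linarith
  -- the matrix transport lemma: `r² ‖DU‖ ≤ R² + (D/a) log(r/R)`
  have hm1 : ∀ y : EuclideanSpace ℝ (Fin 3), ‖y‖ = R → ‖fderiv ℝ U y‖ ≤ 1 := by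
    intro y hy
    have h := (hR₁ y (by rw [hy]; exact hRR₁)).1
    rw [hy] at h
    exact h.trans (by rw [div_le_one hRpos]; exact hR1)
  have hrate : ∀ y : EuclideanSpace ℝ (Fin 3), R ≤ ‖y‖ →
      ‖y‖ ^ 2 * ‖fderiv ℝ U y‖ ≤ R ^ 2 * 1 + D / a * Real.log (‖y‖ / R) :=
    fun y hy => sq_mul_norm_le_of_transport_two ha hB hDUd hRpos hm1 hG hy
  -- the power gain `‖DU‖ ≤ C₁ / r^{3/2}`
  set C₁ : ℝ := R ^ 2 + 2 * D / a with hC₁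
  have hC₁0 : 0 ≤ C₁ := by positivity
  have hgain : ∀ y : EuclideanSpace ℝ (Fin 3), R ≤ ‖y‖ → ‖fderiv ℝ U y‖ ≤ C₁ / ‖y‖ ^ (1 + (1 / 2 : ℝ)) := by
    intro y hy
    have hypos : 0 < ‖y‖ := hRpos.trans_le hy
    have hy1 : 1 ≤ ‖y‖ := hR1.trans hy
    have h := hrate y hy
    -- `log(r/R) ≤ 2 (r/R)^{1/2} ≤ 2 r^{1/2}`
    have hlog : Real.log (‖y‖ / R) ≤ 2 * ‖y‖ ^ (1 / 2 : ℝ) := by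
      have h1 := Real.log_le_rpow_div (by positivity : 0 ≤ ‖y‖ / R) (by norm_num : (0 : ℝ) < 1 / 2)
      have h2 : (‖y‖ / R) ^ (1 / 2 : ℝ) ≤ ‖y‖ ^ (1 / 2 : ℝ) :=
        Real.rpow_le_rpow (by positivity) (div_le_self hypos.le hR1) (by norm_num)
      calc Real.log (‖y‖ / R) ≤ (‖y‖ / R) ^ (1 / 2 : ℝ) / (1 / 2) := h1
        _ = 2 * (‖y‖ / R) ^ (1 / 2 : ℝ) := by ring
        _ ≤ 2 * ‖y‖ ^ (1 / 2 : ℝ) := by linarith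
    have hsqrt1 : 1 ≤ ‖y‖ ^ (1 / 2 : ℝ) := Real.one_le_rpow hy1 (by norm_num)
    have hDa : 0 ≤ D / a := div_nonneg hD0 ha.le
    -- `r² ‖DU‖ ≤ C₁ r^{1/2}`
    have h3 : ‖y‖ ^ 2 * ‖fderiv ℝ U y‖ ≤ C₁ * ‖y‖ ^ (1 / 2 : ℝ) := by
      have i1 := mul_le_mul_of_nonneg_left hlog hDa
      have i2 := mul_le_mul_of_nonneg_left hsqrt1 (pow_pos hRpos 2).le
      have e1 : C₁ * ‖y‖ ^ (1 / 2 : ℝ) = R ^ 2 * ‖y‖ ^ (1 / 2 : ℝ) + D / a * (2 * ‖y‖ ^ (1 / 2 : ℝ)) := by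
        rw [hC₁]; ring
      rw [e1]
      linarith
    -- divide: `‖y‖^{1 + 1/2} = ‖y‖² / ‖y‖^{1/2}`
    have hpow : ‖y‖ ^ (1 + (1 / 2 : ℝ)) * ‖y‖ ^ (1 / 2 : ℝ) = ‖y‖ ^ 2 := by
      rw [← Real.rpow_add hypos, show (1 : ℝ) + 1 / 2 + 1 / 2 = 2 by norm_num, Real.rpow_two]
    have hp1 : 0 < ‖y‖ ^ (1 + (1 / 2 : ℝ)) := Real.rpow_pos_of_pos hypos _
    have hp2 : 0 < ‖y‖ ^ (1 / 2 : ℝ) := Real.rpow_pos_of_pos hypos _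
    rw [le_div_iff₀ hp1]
    refine le_of_mul_le_mul_right ?_ hp2
    calc ‖fderiv ℝ U y‖ * ‖y‖ ^ (1 + (1 / 2 : ℝ)) * ‖y‖ ^ (1 / 2 : ℝ) = ‖y‖ ^ 2 * ‖fderiv ℝ U y‖ := by
          rw [mul_assoc, hpow, mul_comm]
      _ ≤ C₁ * ‖y‖ ^ (1 / 2 : ℝ) := h3
  exact typeIRate_of_fderiv_power_decay hν ha hB hU hP hdiv heq ⟨M, hM⟩ hdecay b hlim
    ⟨1 / 2, C₁, R, by norm_num, hgain⟩

end Profile2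

end TypeIRate

end Summit.NavierStokesRegularity.NavierStokesRegularity.Theorems.CoriolisHead

end
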